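import Summits.ABC.Statement
import Literature.StrongHypotheses.ABC
import Literature.NumberTheory.DiophantineGeometry.AbcWave0QualityFormProofs
import Literature.NumberTheory.DiophantineGeometry.AbcWave0BakerExplicitProofs
import Literature.NumberTheory.DiophantineGeometry.AbcWave0UniformABCProofs
import Literature.NumberTheory.EllipticCurves.SzpiroBGEquivalenceProofs
import Literature.NumberTheory.EllipticCurves.DegreeConjectureAbc
import Literature.Barriers.ABC.EpsilonCannotBeDroppedProofs
import HarnessLib
import HarnessLib.Audit.TribunalTags

/-!
# Summit `ABC` — bridges of the Strong-Hypothesis Library (D-0034, skeleton)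

Summit-side BRIDGE file for the registry `Literature/StrongHypotheses/ABC.lean`: for every `H` tagged there
with `@[strong_hypothesis "ABC.ABC"]`, exactly ONE bridge tagged `@[summit_bridge "ABC.ABC"]`, concluding the
ROOT problem decl `_root_.ABC` (`Summits/ABC/ABC/Statement.lean`; `:= Literature.Abc.ABCConjecture`,
unfolded by `ABC_iff`).

* LANDED bridges (7): four `↔` (equivalent criteria: quality form, modified Szpiro, generalized Szpiro
  (B–G), strong Hall) and three `→` (strictly stronger: Baker's explicit abc, uniform abc over number
  fields, Robert–Stewart–Tenenbaum Conj. A upper half) — each a one-line composition of a theorem already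
  proved in `Literature/` (`abcQualityForm_iff_forall_exists_const`, `abcLe_iff_modifiedSzpiro_holds`,
  `strongHall_iff_generalizedSzpiroBG`, `abcLe_iff_strongHall`, `BakerExplicitABC.forall_exists_const`,
  `UniformABCConjecture.abc_rat`, `RSTConjectureAUpper.imp_abc`) with the unfolding `ABC_iff` and the
  `≤`/`<` glue `abc_iff_abcLe` below (Bombieri–Gubler print `c ≤ C(ε) rad(abc)^{1+ε}` with no sign on `C`;
  the summit has `<` and `0 < C`).
* PRINTED bridges (2): `NConjectureAllImpliesABC` (Browkin–Brzeziński 1994 §1: `n = 3` is abc) and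
  `NumberFieldABCConjectureImpliesABC` (`K = ℚ`; Granville–Stark 2000 §1) — NAMED FACTS (CONVENTIONS §4)
  to be discharged by a literature-prover as `theorem …_holds` in
  `Summits/ABC/ABC/Theorems/StrongHypotheses<H>Bridge.lean` (proof plans in the docstrings).

No summit-side conjecture def is tagged here: the closed `…Conjecture : Prop` decls under `Summits/ABC/ABC/`
are Theses decls or live in unbuilt `Cruxes/…/Sketch*` files (see the registry's "Deliberately NOT
registered"). No new mathematics; no `sorry`, no axiom.
-/

noncomputable section

namespace Summit.ABC.StrongHypotheses

open Literature.NumberTheory.DiophantineGeometry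
open Literature.NumberTheory.EllipticCurves
open Literature.Barriers.ABC
open Literature.StrongHypotheses.ABC

/-! ## Glue: the summit's strict form versus the printed `≤`-form -/

/-- `ABC` (strict `<`, `0 < C`) is equivalent to the `≤`-form of Bombieri–Gubler, Conj. 12.2.2 (no sign
condition on `C(ε)`) over `IsABCTriple`/`rad` — the audit's `ABC_iff_BG`; `≤ ⟹ <` is `abcLt_of_abcLe`
(`DegreeConjectureAbc.lean`, `C ↦ max C 0 + 1`). [folklore] -/
theorem abc_iff_abcLe :
    _root_.ABC ↔ ∀ ε : ℝ, 0 < ε → ∃ C : ℝ, ∀ a b c : ℕ, IsABCTriple a b c →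
      (c : ℝ) ≤ C * ((rad a b c : ℕ) : ℝ) ^ (1 + ε) :=
  ⟨fun h ε hε => by
      obtain ⟨C, -, hC⟩ := ABC_iff.mp h ε hε
      exact ⟨C, fun a b c t => (hC a b c t).le⟩,
    fun h => ABC_iff.mpr (abcLt_of_abcLe h)⟩

/-! ## Equivalent criteria (landed) -/

/-- **Quality form ⇔ summit** (landed): `abcQualityForm_iff_forall_exists_const`
(`AbcWave0QualityFormProofs`; Waldschmidt 2014, Conj. 2 "easily seen to be equivalent"), whose right-hand
side is verbatim the body of `ABC`. [cite: Waldschmidt2014, Conjecture 2] -/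
@[summit_bridge "ABC.ABC"]
theorem abcQualityForm_iff_abc : ABCQualityForm ↔ _root_.ABC :=
  abcQualityForm_iff_forall_exists_const.trans ABC_iff.symm

/-- **Modified Szpiro ⇔ summit** (landed): Oesterlé 1988, §3, pp. 169–170, in tree
`abcLe_iff_modifiedSzpiro_holds` (`SzpiroBGEquivalenceProofs`, via Bombieri–Gubler Thm. 12.5.12),
composed with `abc_iff_abcLe`. [cite: Oesterle1988, §3 Conj. 4, pp. 169–170] -/
@[summit_bridge "ABC.ABC"]
theorem modifiedSzpiro_iff_abc : ModifiedSzpiroConjecture ↔ _root_.ABC :=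
  abcLe_iff_modifiedSzpiro_holds.symm.trans abc_iff_abcLe.symm

/-- **Strong Hall ⇔ summit** (landed): Bombieri–Gubler Thm. 12.5.12 (a) ⟺ (b), in tree
`abcLe_iff_strongHall` (`SzpiroBGEquivalenceProofs`), composed with `abc_iff_abcLe`.
[cite: BombieriGubler2006, Thm. 12.5.12] -/
@[summit_bridge "ABC.ABC"]
theorem strongHall_iff_abc : StrongHallConjecture ↔ _root_.ABC :=
  abcLe_iff_strongHall.symm.trans abc_iff_abcLe.symm

/-- **Generalized Szpiro (B–G 12.5.11) ⇔ summit** (landed): Bombieri–Gubler Thm. 12.5.12 (b) ⟺ (c),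
in tree `strongHall_iff_generalizedSzpiroBG` (`SzpiroBGEquivalenceProofs`), composed with
`strongHall_iff_abc`. [cite: BombieriGubler2006, Thm. 12.5.12] -/
@[summit_bridge "ABC.ABC"]
theorem generalizedSzpiroBG_iff_abc : GeneralizedSzpiroConjectureBG ↔ _root_.ABC :=
  strongHall_iff_generalizedSzpiroBG.symm.trans strongHall_iff_abc

/-! ## Strictly stronger hypotheses (landed) -/

/-- **Baker's explicit abc ⟹ summit** (landed): `BakerExplicitABC.forall_exists_const`
(`AbcWave0BakerExplicitProofs`; Baker 2004 §3, "Conjecture 4 … enables one to give an explicit expression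
for the implied constant depending on `ε`"). [cite: Baker2004, §3 (pp. 257–258)] -/
@[summit_bridge "ABC.ABC"]
theorem bakerExplicitABC_imp_abc : BakerExplicitABC → _root_.ABC :=
  fun h => ABC_iff.mpr h.forall_exists_const

/-- **Uniform abc over number fields ⟹ summit** (landed): the case `K = ℚ`,
`UniformABCConjecture.abc_rat` (`AbcWave0UniformABCProofs`; Granville–Stark 2000 §1, opening sentence and
eq. (1)). [cite: GranvilleStark2000, §1 eq. (1)] -/
@[summit_bridge "ABC.ABC"]
theorem uniformABC_imp_abc : UniformABCConjecture → _root_.ABC :=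
  fun h => ABC_iff.mpr (UniformABCConjecture.abc_rat h)

/-- **Robert–Stewart–Tenenbaum Conj. A (upper half) ⟹ summit** (landed): `RSTConjectureAUpper.imp_abc`
(`EpsilonCannotBeDroppedProofs`; RST 2014, remark after Conj. A: (1·5) gives (1·3) with `A₂ = 4√3 + ε`,
a fortiori `c ≪_ε k^{1+ε}`). [cite: RobertStewartTenenbaum2014, Conjecture A and the remark following it] -/
@[summit_bridge "ABC.ABC"]
theorem rstConjectureAUpper_imp_abc : RSTConjectureAUpper → _root_.ABC :=
  fun h => ABC_iff.mpr h.imp_abc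

/-! ## Strictly stronger hypotheses (printed bridges = named facts) -/

/-- **`n`-conjecture (all `n ≥ 3`) ⟹ abc** — named fact: Browkin–Brzeziński's `n`-conjecture for every
`n ≥ 3` (`NConjectureAll`) implies the summit, because its case `n = 3` (exponent `2·3 − 5 = 1`) is the abc
conjecture in the integer form `a₁ + a₂ + a₃ = 0` (Browkin–Brzeziński 1994, §1). PROOF PLAN for the
discharge `theorem NConjectureAllImpliesABC_holds` (target
`Summits/ABC/ABC/Theorems/StrongHypothesesNConjectureAllBridge.lean`): given an abc triple `(a, b, c)`,
apply `NConjecture 3` to `![a, b, -c] : Fin 3 → ℤ` (sum `0`; a common divisor `d` divides `gcd(a,b) = 1`,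
so `IsUnit d`; no proper nonempty subsum vanishes since `a, b, c > 0` and `a, b < c`); read off
`c = |−c| ≤ C · rad(−abc)^{1+ε}` with `radical (∏ i, ![a,b,-c] i) = radical (a*b*c : ℤ)` (radical ignores
units/sign; cast `ℕ → ℤ → ℝ` matches `rad a b c` via `Int.natAbs`/`Nat.cast` of the radical, cf. the
`SzpiroHallProofs`/`StrongHall` cast lemmas), obtaining the `≤`-form; finish with `abc_iff_abcLe.mpr`.
[cite: BrowkinBrzezinski1994, §1 (n = 3 is the abc-conjecture)] -/
@[summit_bridge "ABC.ABC"]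
def NConjectureAllImpliesABC : Prop :=
  NConjectureAll → _root_.ABC

/-- **abc over every number field ⟹ abc** — named fact: `NumberFieldABCConjecture` at `K = ℚ` is the
summit ("Oesterlé and Masser's abc-conjecture asserts that … `c ≪_ε N(a,b,c)^{1+ε}`", the case `K = ℚ`;
Granville–Stark 2000 §1; Evertse–Győry 2015 §4.6 "For `K = ℚ`, this reduces to the Oesterlé–Masser
Conjecture"). PROOF PLAN for the discharge `theorem NumberFieldABCConjectureImpliesABC_holds` (target
`Summits/ABC/ABC/Theorems/StrongHypothesesNumberFieldABCConjectureBridge.lean`): copy the proof of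
`UniformABCConjecture.abc_rat` (`AbcWave0UniformABCProofs`) with `K := ℚ` — for an abc triple viewed in
`ℚ`, `Height.mulHeight ![a,b,c] = c` (`UniformABCConjecture.mulHeight_natCast_eq`, from
`Rat.mulHeight_eq_max_abs_of_gcd_eq_one`) and `radicalNorm a b c ≤ rad a b c`
(`UniformABCConjecture.radicalNorm_natCast_le_rad`); the discriminant factor is simply absent here;
replace `C` by `max C 1 > 0` and conclude with `ABC_iff.mpr`.
[cite: GranvilleStark2000, §1 (opening sentence) with eq. (1)] -/
@[summit_bridge "ABC.ABC"]
def NumberFieldABCConjectureImpliesABC : Prop :=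
  NumberFieldABCConjecture → _root_.ABC

end Summit.ABC.StrongHypotheses
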